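import Summits.BirchSwinnertonDyer.BirchSwinnertonDyer.Theorems.TwoAdicConverseMultiplicativeInputs
import Literature.NumberTheory.EllipticCurves.BSDSelmerParityDokchitserBaseChangeProofs
import HarnessLib

/-!
# Route `TwoAdicConverse`, multiplicative node — the layer-2 GLUE item
(stmt-BirchSwinnertonDyer-19188, `MultiplicativeRankZeroTwoConverseOfChildren`)

The glued split (gen 1) of the crux `MultiplicativeRankZeroTwoConverse` (stmt-BirchSwinnertonDyer-19219:
the rank-`0` 2-converse for every non-CM `E/ℚ` multiplicative at `2`) into the support
`MultConversePublishedInputsAtTwo` (Kato 2004 Cor. 14.3 at `p = 2` ∧ modularity as analytic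
continuation), the support `MultTwistSupplyAtTwo` (a quadratic `K` with `2` split and
`L(E^(d_K),1) ≠ 0`) and the crux `MultTwoConverseOverKAtTwo` (the corank-`0` 2-converse over every such
`K`). The glue is ONE application of the landed bridge
`Summit.BirchSwinnertonDyer.BirchSwinnertonDyer.Theorems.multiplicativeRankZeroTwoConverse_of_overK`
(p409715, `Theorems/TwoAdicConverseMultiplicativeInputs.lean`) with the tree THEOREM
`selmerCorank_baseChange_quadratic_holds` (Dokchitser–Dokchitser 2010 Lemma 4.14, PROVED in the tree)
inserted for the middle conjunct of its PRINT bundle. Composition certificate; nothing asserted, no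
hypothesis beyond the three children. Seat bsd-2adic-conv-2 (D-0074 (A)); kernel-identical to the
planner's certificate plan/routes/split-g10/Sketch-S4.lean.
-/

set_option linter.dupNamespace false

namespace Summit.BirchSwinnertonDyer.BirchSwinnertonDyer.Theorems

/-- **Glue (item stmt-BirchSwinnertonDyer-19188).** The three children of the multiplicative node of
route TwoAdicConverse — `MultConversePublishedInputsAtTwo` (Kato Cor. 14.3 at `2` ∧ modularity),
`MultTwistSupplyAtTwo` (twist supply with `2` split) and `MultTwoConverseOverKAtTwo` (corank-`0`
2-converse over the auxiliary quadratic field) — imply the parent `MultiplicativeRankZeroTwoConverse`,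
by one application of the bridge `multiplicativeRankZeroTwoConverse_of_overK` (p409715) and the
proved Dokchitser–Dokchitser Lemma 4.14 (`selmerCorank_baseChange_quadratic_holds`).
[cite: DokchitserDokchitser2010, Lemma 4.14] -/
theorem multiplicativeRankZeroTwoConverseOfChildren_proof :
    Summit.BirchSwinnertonDyer.BirchSwinnertonDyer.Theses.TwoAdicConverse.MultiplicativeRankZeroTwoConverseOfChildren := by
  unfold Summit.BirchSwinnertonDyer.BirchSwinnertonDyer.Theses.TwoAdicConverse.MultiplicativeRankZeroTwoConverseOfChildren
  intro hP hT hK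
  exact multiplicativeRankZeroTwoConverse_of_overK
    ⟨hP.1, Literature.NumberTheory.EllipticCurves.selmerCorank_baseChange_quadratic_holds, hP.2⟩ hT hK

end Summit.BirchSwinnertonDyer.BirchSwinnertonDyer.Theorems
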